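import Literature.AlgebraicGeometry.Motives.ProjClosedFractions
import Literature.AlgebraicGeometry.Motives.VarietiesProjectiveSpaceProofs
import Literature.AlgebraicGeometry.Resolution.ExtAnnihilatorCharts
import Mathlib.Algebra.Module.LocalizedModule.IsLocalization
import Mathlib.Algebra.Module.LocalizedModule.Submodule
import HarnessLib

/-!
# The affine charts of a closed subscheme of `ℙⁿ_k` as modules over the chart rings of `ℙⁿ_k`

Topic: `Literature/AlgebraicGeometry/Resolution` (the chart dictionary of the globalization step of
Kawasaki's Macaulayfication, Kawasaki 2000, §5: at a point `p ∈ X ⊆ ℙⁿ`, the local ring `𝒪_{X,p}`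
and its quotients are modules over the REGULAR local ring `𝒪_{ℙⁿ,p}`, a localization of the chart
ring `(k[x]_{(H)})₀`).

For a closed immersion `ι : X → ℙⁿ_k`, a homogeneous `H` of positive degree and an ideal `I` of the
ring of sections `A_H = Γ(X, ι⁻¹D₊(H))`:

* `ChartQuot ι H I = A_H ⧸ I`, an algebra over the chart ring `B_H = (k[x]_{(H)})₀`
  (`HomogeneousLocalization.Away`) through the surjection `evalAway ι H : B_H ↠ A_H`
  (`Literature.AlgebraicGeometry.Motives.ProjFrac.evalAway_surjective`); it is a finite
  `B_H`-module (`algebraMap_chartQuot_surjective`);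
* the chart rings of the standard charts `H = xⱼ` and of their overlaps `H = xⱼ x_l` are
  Noetherian (`(k[x]_{(xⱼ)})₀ ≅ k[y₁,…,yₙ]`, `Motives.ProjectiveSpace.chartAlgEquiv`; the overlap
  ring is a localization of it, Mathlib `HomogeneousLocalization.Away.isLocalization_mul`), so the
  `Ext`-annihilator ideals `extAnn B_H (ChartQuot ι H I) T` (`ExtAnnihilatorCharts.lean`) make
  sense on them;
* `chartAnn ι I T := extAnn (k[x]_{(xⱼ)})₀ (A_{xⱼ} ⧸ I) T`, Kawasaki's annihilator ideal of a
  chart.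

Everything is proved; no named facts.

## References

* T. Kawasaki, *On Macaulayfication of Noetherian schemes*, Trans. AMS 352 (2000), §5. [Kawasaki2000]
* R. Hartshorne, *Algebraic Geometry* (1977), II Prop. 2.5, II Prop. 5.9. [Hartshorne1977]
-/

noncomputable section

open CategoryTheory AlgebraicGeometry TopologicalSpace HomogeneousLocalization MvPolynomial
open Literature.AlgebraicGeometry.Morphisms Literature.AlgebraicGeometry.Morphisms.ProjCech
open Literature.AlgebraicGeometry.Motives Literature.AlgebraicGeometry.Motives.ProjFrac

universe u

attribute [local instance] MvPolynomial.gradedAlgebra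
  Literature.AlgebraicGeometry.Motives.ProjBaseChange.algebraBase

namespace Literature.AlgebraicGeometry.Resolution

variable {k : Type u} [Field k] {n : ℕ} {Z : Scheme.{u}} (ι : Z ⟶ PP k n)

/-! ## The chart quotients `A_H ⧸ I` as `B_H`-modules -/

/-- **A quotient `Γ(X, ι⁻¹D₊(H)) ⧸ I` of the ring of sections of a chart of `X`**, as a type of its
own carrying the module structure over the chart ring `(k[x]_{(H)})₀` of `ℙⁿ`. [folklore] -/
def ChartQuot (H : MvPolynomial (Fin (n + 1)) k) (I : Ideal Γ(Z, ZH ι H)) : Type u :=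
  Γ(Z, ZH ι H) ⧸ I

variable (H : MvPolynomial (Fin (n + 1)) k) (I : Ideal Γ(Z, ZH ι H))

/-- The ring structure of the quotient. [folklore] -/
instance ChartQuot.instCommRing : CommRing (ChartQuot ι H I) :=
  inferInstanceAs (CommRing (Γ(Z, ZH ι H) ⧸ I))

/-- `A_H ⧸ I` is an algebra over `(k[x]_{(H)})₀` through `evalAway ι H : (k[x]_{(H)})₀ → A_H`.
[folklore] -/
instance ChartQuot.instAlgebra : Algebra (Away (grading k n) H) (ChartQuot ι H I) :=
  ((Ideal.Quotient.mk I).comp (evalAway ι H)).toAlgebra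

/-- `A_H ⧸ I` is an algebra over `A_H`. [folklore] -/
instance ChartQuot.instAlgebraSections : Algebra Γ(Z, ZH ι H) (ChartQuot ι H I) :=
  inferInstanceAs (Algebra Γ(Z, ZH ι H) (Γ(Z, ZH ι H) ⧸ I))

/-- The structure map `(k[x]_{(H)})₀ → A_H ⧸ I` is `mk ∘ evalAway`. [folklore] -/
theorem algebraMap_chartQuot_apply (b : Away (grading k n) H) :
    algebraMap (Away (grading k n) H) (ChartQuot ι H I) b =
      Ideal.Quotient.mk I (evalAway ι H b) := rfl

/-- For a closed immersion and `deg H > 0` the structure map `(k[x]_{(H)})₀ → A_H ⧸ I` is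
surjective. [cite: Hartshorne1977, II Prop. 5.9] -/
theorem algebraMap_chartQuot_surjective [IsClosedImmersion ι] {m : ℕ} (hH : H ∈ grading k n m)
    (hm : 0 < m) : Function.Surjective (algebraMap (Away (grading k n) H) (ChartQuot ι H I)) :=
  Ideal.Quotient.mk_surjective.comp (evalAway_surjective ι hH hm)

/-- Hence `A_H ⧸ I` is a finite `(k[x]_{(H)})₀`-module. [folklore] -/
theorem ChartQuot.finite [IsClosedImmersion ι] {m : ℕ} (hH : H ∈ grading k n m) (hm : 0 < m) :
    Module.Finite (Away (grading k n) H) (ChartQuot ι H I) :=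
  Module.Finite.of_surjective (Algebra.linearMap _ _) (algebraMap_chartQuot_surjective ι H I hH hm)

/-- The standard charts: `A_{xⱼ} ⧸ I` is a finite `(k[x]_{(xⱼ)})₀`-module. [folklore] -/
instance ChartQuot.finite_X [IsClosedImmersion ι] (j : Fin (n + 1)) (I : Ideal Γ(Z, ZH ι (X j))) :
    Module.Finite (Away (grading k n) (X j : MvPolynomial (Fin (n + 1)) k)) (ChartQuot ι (X j) I) :=
  ChartQuot.finite ι (X j) I (Segre.X_mem k j) one_pos

/-- `xⱼ x_l` is homogeneous of degree `2`. [folklore] -/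
theorem X_mul_X_mem (j l : Fin (n + 1)) :
    (X j * X l : MvPolynomial (Fin (n + 1)) k) ∈ grading k n 2 :=
  SetLike.mul_mem_graded (Segre.X_mem k j) (Segre.X_mem k l)

/-- The overlaps: `A_{xⱼ x_l} ⧸ I` is a finite `(k[x]_{(xⱼ x_l)})₀`-module. [folklore] -/
instance ChartQuot.finite_XX [IsClosedImmersion ι] (j l : Fin (n + 1))
    (I : Ideal Γ(Z, ZH ι (X j * X l))) :
    Module.Finite (Away (grading k n) (X j * X l : MvPolynomial (Fin (n + 1)) k))
      (ChartQuot ι (X j * X l) I) :=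
  ChartQuot.finite ι (X j * X l) I (X_mul_X_mem j l) two_pos

/-! ## The chart rings are Noetherian -/

/-- `(k[x]_{(xⱼ)})₀ ≅ k[y₁, …, yₙ]` is a Noetherian ring. [folklore] -/
instance isNoetherianRing_away_X (j : Fin (n + 1)) :
    IsNoetherianRing (Away (grading k n) (X j : MvPolynomial (Fin (n + 1)) k)) :=
  isNoetherianRing_of_ringEquiv _ (ProjectiveSpace.chartAlgEquiv k j).symm.toRingEquiv

/-- `(k[x]_{(xⱼ)})₀` is a domain. [folklore] -/
instance isDomain_away_X (j : Fin (n + 1)) :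
    IsDomain (Away (grading k n) (X j : MvPolynomial (Fin (n + 1)) k)) :=
  MulEquiv.isDomain _ (ProjectiveSpace.chartAlgEquiv k j).toMulEquiv

/-- The overlap ring `(k[x]_{(xⱼ x_l)})₀` is the localization of `(k[x]_{(xⱼ)})₀` at `x_l/xⱼ`
(Mathlib `Away.isLocalization_mul`), for the algebra structure `awayMap`. [folklore] -/
@[reducible] def awayMulAlgebra (j l : Fin (n + 1)) :
    Algebra (Away (grading k n) (X j : MvPolynomial (Fin (n + 1)) k))
      (Away (grading k n) (X j * X l : MvPolynomial (Fin (n + 1)) k)) :=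
  (awayMap (grading k n) (Segre.X_mem k l) (rfl : (X j * X l : MvPolynomial (Fin (n + 1)) k) = X j * X l)).toAlgebra

/-- `(k[x]_{(xⱼ x_l)})₀` is the localization of `(k[x]_{(xⱼ)})₀` away from `x_l/xⱼ`. [folklore] -/
theorem isLocalization_away_mul (j l : Fin (n + 1)) :
    letI := awayMulAlgebra (k := k) j l
    IsLocalization.Away (Away.isLocalizationElem (Segre.X_mem k j) (Segre.X_mem k l))
      (Away (grading k n) (X j * X l : MvPolynomial (Fin (n + 1)) k)) :=
  Away.isLocalization_mul (Segre.X_mem k j) (Segre.X_mem k l) rfl one_ne_zero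

/-- `(k[x]_{(xⱼ x_l)})₀` is a Noetherian ring. [folklore] -/
instance isNoetherianRing_away_XX (j l : Fin (n + 1)) :
    IsNoetherianRing (Away (grading k n) (X j * X l : MvPolynomial (Fin (n + 1)) k)) := by
  letI := awayMulAlgebra (k := k) j l
  haveI := isLocalization_away_mul (k := k) j l
  exact IsLocalization.isNoetherianRing
    (Submonoid.powers (Away.isLocalizationElem (Segre.X_mem k j) (Segre.X_mem k l)))
    (Away (grading k n) (X j * X l : MvPolynomial (Fin (n + 1)) k))
    (isNoetherianRing_away_X (k := k) j)

/-! ## Kawasaki's annihilator ideal of a chart -/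

/-- **The annihilator ideal of the `j`-th chart**: `extAnn (k[x]_{(xⱼ)})₀ (A_{xⱼ} ⧸ I) T ≤ (k[x]_{(xⱼ)})₀`
(the `Ext`-annihilator form of Kawasaki's `𝔞(·)` of the affine piece `Spec (A_{xⱼ} ⧸ I)` of a closed
subscheme of `X`, computed over the regular chart ring of `ℙⁿ`). [cite: Kawasaki2000, Def. 2.1, La. 5.3] -/
def chartAnn [IsClosedImmersion ι] (j : Fin (n + 1)) (I : Ideal Γ(Z, ZH ι (X j))) (T : Finset ℕ) :
    Ideal (Away (grading k n) (X j : MvPolynomial (Fin (n + 1)) k)) :=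
  extAnn (Away (grading k n) (X j : MvPolynomial (Fin (n + 1)) k)) (ChartQuot ι (X j) I) T

end Literature.AlgebraicGeometry.Resolution

end
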